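import Mathlib
import Literature.Computability.AlgebraicComplexity.StandardFamilies
import Literature.Computability.AlgebraicComplexity.MignonRessayreBound

/-!
# Crux `RefutationDegree.BeyondHessianSos` (stmt-ValiantsHypothesis-5643), line `Sketch` —
# stub `stub_nilconeSlice` (the `PP` slice of a `J`-nilcone space: `Σ X² = Σ X³ = 0`)

If `L` is a linear space of `m × m` matrices with `per (J + B) = m!` for all `B ∈ L`, then on
`A := L ∩ PP` (`PP` = matrices with vanishing row and column sums) the power sums `Σ X²` and
`Σ X³` vanish, and `dim L + 1 ≤ dim A + 2m`.
-/

set_option linter.dupNamespace false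

noncomputable section

open scoped BigOperators
open MvPolynomial

namespace Summit.ValiantsHypothesis.ValiantsHypothesis.Theorems.RefutationDegreeBeyondHessianSos

open Literature.Computability.AlgebraicComplexity

section Helpers

variable {α : Type*} [Fintype α] [DecidableEq α]

omit [Fintype α] in
/-- The coefficients `0, …, 3` of `∏ᵢ (1 + t yᵢ)` in terms of power sums (Newton). -/
theorem coeff_prod_one_add_X_mul (y : α → ℂ) (s : Finset α) :
    (∏ i ∈ s, (1 + Polynomial.X * Polynomial.C (y i))).coeff 0 = 1 ∧
    (∏ i ∈ s, (1 + Polynomial.X * Polynomial.C (y i))).coeff 1 = ∑ i ∈ s, y i ∧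
    2 * (∏ i ∈ s, (1 + Polynomial.X * Polynomial.C (y i))).coeff 2 =
      (∑ i ∈ s, y i) * (∑ i ∈ s, y i) - ∑ i ∈ s, y i * y i ∧
    6 * (∏ i ∈ s, (1 + Polynomial.X * Polynomial.C (y i))).coeff 3 =
      (∑ i ∈ s, y i) * (∑ i ∈ s, y i) * (∑ i ∈ s, y i) -
        (∑ i ∈ s, y i * y i) * (∑ i ∈ s, y i) - (∑ i ∈ s, y i * y i) * (∑ i ∈ s, y i) -
        (∑ i ∈ s, y i) * (∑ i ∈ s, y i * y i) + 2 * ∑ i ∈ s, y i * y i * y i := by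
  induction s using Finset.induction_on with
  | empty => simp [Polynomial.coeff_one]
  | insert a s ha ih =>
    obtain ⟨h0, h1, h2, h3⟩ := ih
    have hc : ∀ (Q : Polynomial ℂ) (n : ℕ),
        ((1 + Polynomial.X * Polynomial.C (y a)) * Q).coeff (n + 1) =
          Q.coeff (n + 1) + y a * Q.coeff n := by
      intro Q n
      rw [show (1 + Polynomial.X * Polynomial.C (y a)) * Q =
          Q + Polynomial.X * (Polynomial.C (y a) * Q) by ring, Polynomial.coeff_add,
        Polynomial.coeff_X_mul, Polynomial.coeff_C_mul]
    rw [Finset.prod_insert ha, Finset.sum_insert ha, Finset.sum_insert ha, Finset.sum_insert ha,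
      Polynomial.mul_coeff_zero, hc, hc, hc, h0, h1]
    refine ⟨by simp, by ring, ?_, ?_⟩
    · linear_combination h2
    · linear_combination h3 + 3 * y a * h2

/-- Bilinear inclusion–exclusion over ordered pairs of distinct indices. -/
theorem sum_ite_two (a b : α → ℂ) :
    ∑ j, ∑ j', (if j = j' then (0 : ℂ) else 1) * (a j * b j') =
      (∑ j, a j) * (∑ j, b j) - ∑ j, a j * b j := by
  have h : ∀ j j', (if j = j' then (0 : ℂ) else 1) * (a j * b j') =
      a j * b j' - if j = j' then a j * b j' else 0 := by
    intro j j'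
    split_ifs <;> ring
  simp_rw [h, Finset.sum_sub_distrib, Finset.sum_ite_eq, Finset.mem_univ, if_true,
    Finset.sum_mul_sum]

/-- Trilinear inclusion–exclusion over ordered triples of pairwise distinct indices. -/
theorem sum_ite_three (a b c : α → ℂ) :
    ∑ j, ∑ j', ∑ j'', (if j = j' ∨ j = j'' ∨ j' = j'' then (0 : ℂ) else 1) * (a j * b j' * c j'') =
      (∑ j, a j) * (∑ j, b j) * (∑ j, c j) - (∑ j, a j * b j) * (∑ j, c j) -
        (∑ j, a j * c j) * (∑ j, b j) - (∑ j, a j) * (∑ j, b j * c j) +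
        2 * ∑ j, a j * b j * c j := by
  have h1 : ∀ j j', ∑ j'', (if j = j' ∨ j = j'' ∨ j' = j'' then (0 : ℂ) else 1) *
      (a j * b j' * c j'') = (∑ j, c j) * ((if j = j' then (0 : ℂ) else 1) * (a j * b j')) -
        (if j = j' then (0 : ℂ) else 1) * ((a j * c j) * b j') -
        (if j = j' then (0 : ℂ) else 1) * (a j * (b j' * c j')) := by
    intro j j'
    by_cases hjj : j = j'
    · simp [hjj]
    have h : ∀ j'', (if j = j' ∨ j = j'' ∨ j' = j'' then (0 : ℂ) else 1) * (a j * b j' * c j'') =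
        a j * b j' * c j'' - (if j'' = j then a j * b j' * c j'' else 0) -
          (if j'' = j' then a j * b j' * c j'' else 0) := by
      intro j''
      by_cases h1 : j'' = j
      · subst h1; simp [hjj]
      · by_cases h2 : j'' = j'
        · subst h2; simp [hjj, h1]
        · simp [hjj, h1, h2, Ne.symm h1, Ne.symm h2]
    simp_rw [h, Finset.sum_sub_distrib, Finset.sum_ite_eq', Finset.mem_univ, if_true, if_neg hjj,
      ← Finset.mul_sum]
    ring
  have t2 : ∑ j, a j * c j * b j = ∑ j, a j * b j * c j :=
    Finset.sum_congr rfl fun _ _ => by ring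
  have t3 : ∑ j, a j * (b j * c j) = ∑ j, a j * b j * c j :=
    Finset.sum_congr rfl fun _ _ => by ring
  simp_rw [h1, Finset.sum_sub_distrib, ← Finset.mul_sum, sum_ite_two, t2, t3]
  ring

omit [DecidableEq α] in
/-- Moving an inner sum out of a weighted double sum. -/
theorem sum_sum_mul_sum {β : Type*} [Fintype β] (w : α → α → ℂ) (T : α → α → β → ℂ) :
    ∑ i, ∑ i', w i i' * ∑ x, T i i' x = ∑ x, ∑ i, ∑ i', w i i' * T i i' x := by
  calc ∑ i, ∑ i', w i i' * ∑ x, T i i' x = ∑ i, ∑ x, ∑ i', w i i' * T i i' x := by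
        refine Finset.sum_congr rfl fun i _ => ?_
        simp_rw [Finset.mul_sum]
        exact Finset.sum_comm
    _ = ∑ x, ∑ i, ∑ i', w i i' * T i i' x := Finset.sum_comm

omit [DecidableEq α] in
/-- Moving an inner sum out of a weighted triple sum. -/
theorem sum_sum_sum_mul_sum {β : Type*} [Fintype β] (w : α → α → α → ℂ)
    (T : α → α → α → β → ℂ) :
    ∑ i, ∑ i', ∑ i'', w i i' i'' * ∑ x, T i i' i'' x =
      ∑ x, ∑ i, ∑ i', ∑ i'', w i i' i'' * T i i' i'' x := by
  calc ∑ i, ∑ i', ∑ i'', w i i' i'' * ∑ x, T i i' i'' x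
        = ∑ i, ∑ x, ∑ i', ∑ i'', w i i' i'' * T i i' i'' x :=
          Finset.sum_congr rfl fun i _ => sum_sum_mul_sum (w i) (T i)
    _ = ∑ x, ∑ i, ∑ i', ∑ i'', w i i' i'' * T i i' i'' x := Finset.sum_comm

/-- `Σ_σ G (σ i) (σ i') = (|α| - 2)! · Σ_{j ≠ j'} G j j'` for `i ≠ i'`. -/
theorem sum_perm_pair {i i' : α} (hi : i ≠ i') (G : α → α → ℂ) :
    ∑ σ : Equiv.Perm α, G (σ i) (σ i') = ((Fintype.card α - 2).factorial : ℂ) *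
      ∑ j, ∑ j', (if j = j' then (0 : ℂ) else 1) * G j j' := by
  rw [← Finset.sum_fiberwise' Finset.univ (fun σ : Equiv.Perm α => (σ i, σ i'))
    (fun p => G p.1 p.2), Fintype.sum_prod_type, Finset.mul_sum]
  refine Finset.sum_congr rfl fun j _ => ?_
  rw [Finset.mul_sum]
  refine Finset.sum_congr rfl fun j' _ => ?_
  rw [Finset.sum_const, nsmul_eq_mul]
  by_cases hj : j = j'
  · subst hj
    rw [if_pos rfl, zero_mul, mul_zero, Finset.card_eq_zero.mpr, Nat.cast_zero, zero_mul]
    refine Finset.filter_eq_empty_iff.mpr fun σ _ h => hi (σ.injective ?_)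
    rw [Prod.mk.injEq] at h
    rw [h.1, h.2]
  · rw [if_neg hj, one_mul]
    congr 1
    rw [← card_perm_apply_eq_two hi hj, Fintype.card_subtype]
    simp only [Prod.mk.injEq]

/-- `Σ_σ G (σ i) (σ i') (σ i'') = (|α| - 3)! · Σ_{j, j', j'' distinct} G j j' j''` for distinct
`i, i', i''`. -/
theorem sum_perm_triple {i i' i'' : α} (h1 : i ≠ i') (h2 : i ≠ i'') (h3 : i' ≠ i'')
    (G : α → α → α → ℂ) :
    ∑ σ : Equiv.Perm α, G (σ i) (σ i') (σ i'') = ((Fintype.card α - 3).factorial : ℂ) *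
      ∑ j, ∑ j', ∑ j'', (if j = j' ∨ j = j'' ∨ j' = j'' then (0 : ℂ) else 1) * G j j' j'' := by
  rw [← Finset.sum_fiberwise' Finset.univ (fun σ : Equiv.Perm α => (σ i, σ i', σ i''))
    (fun p => G p.1 p.2.1 p.2.2), Fintype.sum_prod_type, Finset.mul_sum]
  refine Finset.sum_congr rfl fun j _ => ?_
  rw [Fintype.sum_prod_type, Finset.mul_sum]
  refine Finset.sum_congr rfl fun j' _ => ?_
  rw [Finset.mul_sum]
  refine Finset.sum_congr rfl fun j'' _ => ?_
  rw [Finset.sum_const, nsmul_eq_mul]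
  by_cases hj : j = j' ∨ j = j'' ∨ j' = j''
  · rw [if_pos hj, zero_mul, mul_zero, Finset.card_eq_zero.mpr, Nat.cast_zero, zero_mul]
    refine Finset.filter_eq_empty_iff.mpr fun σ _ h => ?_
    simp only [Prod.mk.injEq] at h
    obtain ⟨ha, hb, hc⟩ := h
    rcases hj with hj | hj | hj
    · exact h1 (σ.injective (by rw [ha, hb, hj]))
    · exact h2 (σ.injective (by rw [ha, hc, hj]))
    · exact h3 (σ.injective (by rw [hb, hc, hj]))
  · rw [if_neg hj, one_mul]
    simp only [not_or] at hj
    congr 1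
    rw [← card_perm_apply_eq_three h1 h2 h3 hj.1 hj.2.1 hj.2.2, Fintype.card_subtype]
    simp only [Prod.mk.injEq]

/-- The row-sum/column-sum map `X ↦ ((Σ_j X_{ij})_i, (Σ_i X_{ij})_j)` is linear. -/
theorem exists_rowColSum (m : ℕ) : ∃ f : (Fin m × Fin m → ℂ) →ₗ[ℂ] (Fin m → ℂ) × (Fin m → ℂ),
    ∀ X, f X = (fun i => ∑ j, X (i, j), fun j => ∑ i, X (i, j)) :=
  ⟨{ toFun := fun X => (fun i => ∑ j, X (i, j), fun j => ∑ i, X (i, j))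
     map_add' := fun X Y => by ext <;> simp [Finset.sum_add_distrib]
     map_smul' := fun c X => by ext <;> simp [Finset.mul_sum] }, fun _ => rfl⟩

/-- The power sums `Σ X²` and `Σ X³` vanish on a doubly-balanced matrix `Y` with
`per (J + tY) ≡ m!`. -/
theorem powerSum_eq_zero {m : ℕ} (Y : Fin m × Fin m → ℂ)
    (hrow : ∀ i, ∑ j, Y (i, j) = 0) (hcol : ∀ j, ∑ i, Y (i, j) = 0)
    (hper : ∀ t : ℂ, ∑ σ : Equiv.Perm (Fin m), ∏ i, (1 + t * Y (σ i, i)) = (m.factorial : ℂ)) :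
    ∑ ij, Y ij ^ 2 = 0 ∧ ∑ ij, Y ij ^ 3 = 0 := by
  set P : Equiv.Perm (Fin m) → Polynomial ℂ :=
    fun σ => ∏ i, (1 + Polynomial.X * Polynomial.C (Y (σ i, i))) with hP
  have hsum : ∑ σ, P σ = Polynomial.C (m.factorial : ℂ) := by
    refine Polynomial.funext fun t => ?_
    simp only [hP, Polynomial.eval_finsetSum, Polynomial.eval_prod, Polynomial.eval_add,
      Polynomial.eval_one, Polynomial.eval_mul, Polynomial.eval_X, Polynomial.eval_C]
    exact hper t
  have hcoeff : ∀ k, k ≠ 0 → ∑ σ, (P σ).coeff k = 0 := fun k hk => by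
    rw [← Polynomial.finsetSum_coeff, hsum, Polynomial.coeff_C, if_neg hk]
  constructor
  · -- quadratic power sum
    have A2 : ∑ i, ∑ i', (if i = i' then (0 : ℂ) else 1) *
        ∑ σ : Equiv.Perm (Fin m), Y (σ i, i) * Y (σ i', i') = 0 := by
      rw [sum_sum_mul_sum]
      calc _ = ∑ σ, 2 * (P σ).coeff 2 := Finset.sum_congr rfl fun σ _ => by
              rw [(coeff_prod_one_add_X_mul (fun i => Y (σ i, i)) Finset.univ).2.2.1, sum_ite_two]
        _ = 0 := by rw [← Finset.mul_sum, hcoeff 2 two_ne_zero, mul_zero]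
    have B2 : ∀ i i', (if i = i' then (0 : ℂ) else 1) *
        ∑ σ : Equiv.Perm (Fin m), Y (σ i, i) * Y (σ i', i') =
        -(((m - 2).factorial : ℂ) * ((if i = i' then (0 : ℂ) else 1) *
          ∑ j, Y (j, i) * Y (j, i'))) := by
      intro i i'
      by_cases h : i = i'
      · simp [h]
      · rw [sum_perm_pair h fun j j' => Y (j, i) * Y (j', i'), sum_ite_two, hcol, hcol,
          Fintype.card_fin]
        simp
    simp_rw [B2, Finset.sum_neg_distrib, ← Finset.mul_sum, sum_sum_mul_sum, sum_ite_two, hrow,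
      zero_mul, zero_sub, Finset.sum_neg_distrib] at A2
    rw [Fintype.sum_prod_type]
    simpa [pow_two, Nat.factorial_ne_zero] using A2
  · -- cubic power sum
    have A3 : ∑ i, ∑ i', ∑ i'', (if i = i' ∨ i = i'' ∨ i' = i'' then (0 : ℂ) else 1) *
        ∑ σ : Equiv.Perm (Fin m), Y (σ i, i) * Y (σ i', i') * Y (σ i'', i'') = 0 := by
      rw [sum_sum_sum_mul_sum]
      calc _ = ∑ σ, 6 * (P σ).coeff 3 := Finset.sum_congr rfl fun σ _ => by
              rw [(coeff_prod_one_add_X_mul (fun i => Y (σ i, i)) Finset.univ).2.2.2,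
                sum_ite_three]
        _ = 0 := by rw [← Finset.mul_sum, hcoeff 3 three_ne_zero, mul_zero]
    have B3 : ∀ i i' i'', (if i = i' ∨ i = i'' ∨ i' = i'' then (0 : ℂ) else 1) *
        ∑ σ : Equiv.Perm (Fin m), Y (σ i, i) * Y (σ i', i') * Y (σ i'', i'') =
        ((m - 3).factorial : ℂ) * (2 * ((if i = i' ∨ i = i'' ∨ i' = i'' then (0 : ℂ) else 1) *
          ∑ j, Y (j, i) * Y (j, i') * Y (j, i''))) := by
      intro i i' i''
      by_cases h : i = i' ∨ i = i'' ∨ i' = i''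
      · simp [h]
      · simp only [not_or] at h
        rw [sum_perm_triple h.1 h.2.1 h.2.2 fun j j' j'' => Y (j, i) * Y (j', i') * Y (j'', i''),
          sum_ite_three, hcol, hcol, hcol, Fintype.card_fin, if_neg (by tauto)]
        ring
    simp_rw [B3, ← Finset.mul_sum, sum_sum_sum_mul_sum, sum_ite_three, hrow,
      zero_mul, mul_zero, sub_zero, zero_add, ← Finset.mul_sum] at A3
    rw [Fintype.sum_prod_type]
    simpa [pow_succ, mul_assoc, Nat.factorial_ne_zero] using A3

end Helpers

/-- **Stub `stub_nilconeSlice`.** If `L` is a linear space of `m × m` complex matrices on which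
`per (J + B) ≡ m!` (`J` the all-ones matrix), then `A := L ∩ PP`, `PP` the matrices with zero
row and column sums, satisfies `Σ X² = Σ X³ = 0` for all `X ∈ A` (expand `per (J + tX) ≡ m!`
in `t`: the `t²` and `t³` coefficients are `(m-2)! Σ X²` and `4 (m-3)! Σ X³ / 6` on `PP`), and
`dim L + 1 ≤ dim A + 2m` since `codim PP = 2m - 1`. -/
theorem stub_nilconeSlice (m : ℕ) (hm : 3 ≤ m) (L : Submodule ℂ (Fin m × Fin m → ℂ))
    (hL : ∀ B ∈ L, MvPolynomial.eval (fun ij : Fin m × Fin m => 1 + B ij) (perPoly (Fin m) ℂ) =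
      (Nat.factorial m : ℂ)) :
    ∃ A : Submodule ℂ (Fin m × Fin m → ℂ),
      (∀ X ∈ A, ∑ ij, X ij ^ 2 = 0) ∧ (∀ X ∈ A, ∑ ij, X ij ^ 3 = 0) ∧
      Module.finrank ℂ L + 1 ≤ Module.finrank ℂ A + 2 * m := by
  obtain ⟨f, hf⟩ := exists_rowColSum m
  have key : ∀ X ∈ L ⊓ LinearMap.ker f, ∑ ij, X ij ^ 2 = 0 ∧ ∑ ij, X ij ^ 3 = 0 := by
    intro X hX
    obtain ⟨hXL, hXK⟩ := Submodule.mem_inf.mp hX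
    rw [LinearMap.mem_ker, hf, Prod.ext_iff] at hXK
    refine powerSum_eq_zero X (fun i => congr_fun hXK.1 i) (fun j => congr_fun hXK.2 j)
      fun t => ?_
    have h := hL (t • X) (L.smul_mem t hXL)
    rw [eval_perPoly] at h
    simpa [Matrix.permanent] using h
  refine ⟨L ⊓ LinearMap.ker f, fun X hX => (key X hX).1, fun X hX => (key X hX).2, ?_⟩
  have h1 := Submodule.finrank_sup_add_finrank_inf_eq L (LinearMap.ker f)
  have h2 := LinearMap.finrank_range_add_finrank_ker f
  have h3 : Module.finrank ℂ ↥(L ⊔ LinearMap.ker f) ≤ Module.finrank ℂ (Fin m × Fin m → ℂ) :=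
    Submodule.finrank_le _
  have h4 : Module.finrank ℂ ↥(LinearMap.range f) <
      Module.finrank ℂ ((Fin m → ℂ) × (Fin m → ℂ)) := by
    refine Submodule.finrank_lt fun htop => ?_
    have i₀ : Fin m := ⟨0, by omega⟩
    have hmem : (Pi.single i₀ (1 : ℂ), (0 : Fin m → ℂ)) ∈ LinearMap.range f :=
      htop ▸ Submodule.mem_top
    obtain ⟨X, hX⟩ := hmem
    have hbal : ∑ i, (f X).1 i = ∑ j, (f X).2 j := by
      rw [hf]
      dsimp only
      exact Finset.sum_comm
    rw [hX] at hbal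
    simp at hbal
  have h5 : Module.finrank ℂ ((Fin m → ℂ) × (Fin m → ℂ)) = m + m := by simp
  omega

end Summit.ValiantsHypothesis.ValiantsHypothesis.Theorems.RefutationDegreeBeyondHessianSos

end
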